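import Summits.SmoothPoincare4.SmoothPoincare4.Theorems.SymplecticOrigamiOrigamiFoldExistenceStubOuterCleanRecognitionChartChimney
import Summits.SmoothPoincare4.SmoothPoincare4.Theorems.SymplecticOrigamiOrigamiFoldExistenceStubCleanOnePleatIroningSeamSheet
import Summits.SmoothPoincare4.SmoothPoincare4.Theorems.SymplecticOrigamiOrigamiFoldExistenceStubCleanOnePleatIroningDeletion

/-!
# Stub `stub_outerCleanRecognitionChart` of line `shadow-pleats` for crux `OrigamiFoldExistence` — G:
# SHEETS OF THE OUTER PART over the shadow plane: the counting sets and their local constancy (item stmt-SmoothPoincare4-7844, route SymplecticOrigami; seat c3, S4''-chart worker)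

Seventh helper file towards `stub_outerCleanRecognitionChart : OuterCleanRecognitionChart`:
the point-set frame of the SHEET COUNT of the lead's structure theorem (O2)
(`OuterClean-analysis-c3.md` §3: off the seam sphere `S_ρ` and the outer crease `c_out`, the
number `n_P` of points of the OUTER PART `P⁺ = {h > 1 - δ} ∖ e₀(B̄₂)` over a shadow point is
locally constant, and changes by `±1` across `S_ρ` / `c_out`).  No degree theory: as in the
S6 count (`…StubPleatFreeStandardSheets`), the loci "no sheet", "exactly one sheet", "at least
two sheets" are shown OPEN off `S_ρ ∪ c_out`, which is all the propagation argument of the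
later files needs.  For a `1`-chart pleated position `(ι, δ, e)` of a compact `M`:

* `outerPart ι δ e₀` (`P⁺`, open), `outerPartK ι δ e₀ = {h ≥ 1 - δ} ∖ e₀(B₂)` (`P̄⁺`, compact),
  `shadow_mem_of_mem_diff` (points of `P̄⁺ ∖ P⁺` cast their shadow on `S_ρ ∪ c_out`);
* the counting sets `sheet0`, `sheet1`, `sheet2 : Set ℝ⁴` (no / exactly one / at least two
  points of `P⁺` over `y`), their trichotomy, and OPENNESS: `isOpen_sheet2`, and off
  `S_ρ ∪ c_out`: `sheet0` is locally `(shadow P̄⁺)ᶜ` (`exists_ball_subset_sheet0`) and `sheet1`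
  is open (`exists_ball_subset_sheet1`) — local injectivity and openness of the shadow at
  points of `P⁺` (`exists_nhds_injOn_outerPart`) plus properness (compactness of `P̄⁺`);
* **`exists_ball_sheets_const`** (registered helper): off `S_ρ ∪ c_out` each of the three
  counting sets is LOCALLY CONSTANT (a whole ball around the point lies in the same one).

Sources: the S6 files `…StubPleatFreeStandardSeam/Sheets` (seat 1); the lead's
`OuterClean-analysis-c3.md` §3 (O2)(a).
-/

noncomputable section

-- the prescribed namespace `Summit.<P>.<Sub>.…` duplicates `SmoothPoincare4` (P = Sub)
set_option linter.dupNamespace false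

open scoped Manifold ContDiff Topology RealInnerProductSpace
open Set Function Filter Metric

namespace Summit.SmoothPoincare4.SmoothPoincare4.Theorems.OrigamiFoldExistence.ShadowPleats

/-! ### The outer part and the counting sets -/

section Defs

variable {M : Type}

/-- The OUTER PART `P⁺ = {h > 1 - δ} ∖ e₀(B̄₂)`: points strictly above the plane and off the
closed chart ball. -/
def outerPart (ι : M → EuclideanSpace ℝ (Fin 5)) (δ : ℝ) (e₀ : EuclideanSpace ℝ (Fin 4) → M) : Set M :=
  {m | 1 - δ < ι m 4} \ e₀ '' Metric.closedBall 0 2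

/-- The CLOSED OUTER PART `P̄⁺ = {h ≥ 1 - δ} ∖ e₀(B₂)` (adds the seam and the outer fold sphere). -/
def outerPartK (ι : M → EuclideanSpace ℝ (Fin 5)) (δ : ℝ) (e₀ : EuclideanSpace ℝ (Fin 4) → M) : Set M :=
  {m | 1 - δ ≤ ι m 4} \ e₀ '' Metric.ball 0 2

/-- NO SHEET over `y`: no point of the outer part casts its shadow on `y`. -/
def sheet0 (ι : M → EuclideanSpace ℝ (Fin 5)) (δ : ℝ) (e₀ : EuclideanSpace ℝ (Fin 4) → M) : Set (EuclideanSpace ℝ (Fin 4)) :=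
  {y | ∀ m ∈ outerPart ι δ e₀, proj5 (ι m) ≠ y}

/-- EXACTLY ONE SHEET over `y`. -/
def sheet1 (ι : M → EuclideanSpace ℝ (Fin 5)) (δ : ℝ) (e₀ : EuclideanSpace ℝ (Fin 4) → M) : Set (EuclideanSpace ℝ (Fin 4)) :=
  {y | ∃ m ∈ outerPart ι δ e₀, proj5 (ι m) = y ∧ ∀ m' ∈ outerPart ι δ e₀, proj5 (ι m') = y → m' = m}

/-- AT LEAST TWO SHEETS over `y`. -/
def sheet2 (ι : M → EuclideanSpace ℝ (Fin 5)) (δ : ℝ) (e₀ : EuclideanSpace ℝ (Fin 4) → M) : Set (EuclideanSpace ℝ (Fin 4)) :=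
  {y | ∃ a ∈ outerPart ι δ e₀, ∃ b ∈ outerPart ι δ e₀, a ≠ b ∧ proj5 (ι a) = y ∧ proj5 (ι b) = y}

variable {ι : M → EuclideanSpace ℝ (Fin 5)} {δ : ℝ} {e₀ : EuclideanSpace ℝ (Fin 4) → M}

/-- The outer part lies in the closed outer part. -/
theorem outerPart_subset_outerPartK : outerPart ι δ e₀ ⊆ outerPartK ι δ e₀ := fun _ hm =>
  ⟨le_of_lt (show 1 - δ < _ from hm.1), fun ⟨u, hu, hum⟩ => hm.2 ⟨u, ball_subset_closedBall hu, hum⟩⟩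

/-- TRICHOTOMY: every shadow point has no sheet, exactly one, or at least two. -/
theorem mem_sheet0_or (y : EuclideanSpace ℝ (Fin 4)) : y ∈ sheet0 ι δ e₀ ∨ y ∈ sheet1 ι δ e₀ ∨ y ∈ sheet2 ι δ e₀ := by
  by_cases hex : ∃ m ∈ outerPart ι δ e₀, proj5 (ι m) = y
  · obtain ⟨m, hm, hmy⟩ := hex
    by_cases huniq : ∀ m' ∈ outerPart ι δ e₀, proj5 (ι m') = y → m' = m
    · exact Or.inr (Or.inl ⟨m, hm, hmy, huniq⟩)
    · push Not at huniq
      obtain ⟨m', hm', hm'y, hne⟩ := huniq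
      exact Or.inr (Or.inr ⟨m', hm', m, hm, hne, hm'y, hmy⟩)
  · push Not at hex
    exact Or.inl fun m hm h => hex m hm h

/-- No sheet excludes one sheet. -/
theorem not_mem_sheet1_of_mem_sheet0 {y : EuclideanSpace ℝ (Fin 4)} (h : y ∈ sheet0 ι δ e₀) : y ∉ sheet1 ι δ e₀ :=
  fun ⟨m, hm, hmy, _⟩ => h m hm hmy

/-- No sheet excludes two sheets. -/
theorem not_mem_sheet2_of_mem_sheet0 {y : EuclideanSpace ℝ (Fin 4)} (h : y ∈ sheet0 ι δ e₀) : y ∉ sheet2 ι δ e₀ :=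
  fun ⟨a, ha, _, _, _, hay, _⟩ => h a ha hay

/-- One sheet excludes two sheets. -/
theorem not_mem_sheet2_of_mem_sheet1 {y : EuclideanSpace ℝ (Fin 4)} (h : y ∈ sheet1 ι δ e₀) : y ∉ sheet2 ι δ e₀ :=
  fun ⟨a, ha, b, hb, hne, hay, hby⟩ => by
    obtain ⟨m, -, -, huniq⟩ := h
    exact hne ((huniq a ha hay).trans (huniq b hb hby).symm)

end Defs

/-! ### The outer part of a pleated position -/

section Pleated

variable {M : Type} [TopologicalSpace M] [ChartedSpace (EuclideanSpace ℝ (Fin 4)) M]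
  {ι : M → EuclideanSpace ℝ (Fin 5)} {δ : ℝ} {e : Fin 1 → EuclideanSpace ℝ (Fin 4) → M}

omit [TopologicalSpace M] [ChartedSpace (EuclideanSpace ℝ (Fin 4)) M] in
/-- A point of `P̄⁺ ∖ P⁺` is on the seam or on the outer fold sphere of the chart. -/
theorem apply_eq_or_mem_of_mem_diff {m : M} (hK : m ∈ outerPartK ι δ (e 0))
    (hP : m ∉ outerPart ι δ (e 0)) : ι m 4 = 1 - δ ∨ m ∈ e 0 '' Metric.sphere 0 2 := by
  by_cases hle : ι m 4 ≤ 1 - δ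
  · exact Or.inl (le_antisymm hle hK.1)
  · right
    have hmem : m ∈ e 0 '' Metric.closedBall 0 2 := by
      by_contra hnot
      exact hP ⟨not_le.1 hle, hnot⟩
    obtain ⟨u, hu, rfl⟩ := hmem
    refine ⟨u, ?_, rfl⟩
    rcases (mem_closedBall_zero_iff.1 hu).lt_or_eq with hlt | heq
    · exact absurd ⟨u, mem_ball_zero_iff.2 hlt, rfl⟩ hK.2
    · exact mem_sphere_zero_iff_norm.2 heq

/-- **Points of `P̄⁺ ∖ P⁺` cast their shadow on the seam sphere `S_ρ` or on the outer crease.** -/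
theorem shadow_mem_of_mem_diff (h : IsPleatedPosition ι δ e) {m : M} (hK : m ∈ outerPartK ι δ (e 0))
    (hP : m ∉ outerPart ι δ (e 0)) :
    proj5 (ι m) ∈ Metric.sphere (0 : EuclideanSpace ℝ (Fin 4)) (Real.sqrt (1 - (1 - δ) ^ 2)) ∪
      (proj5 ∘ ι ∘ e 0) '' Metric.sphere 0 2 := by
  rcases apply_eq_or_mem_of_mem_diff hK hP with hseam | ⟨u, hu, rfl⟩
  · exact Or.inl (mem_sphere_zero_iff_norm.2 (norm_shadow_of_seam h.2.2.2.1 hseam))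
  · exact Or.inr ⟨u, hu, rfl⟩

/-- The outer part is open (for a Hausdorff `M`). -/
theorem isOpen_outerPart [T2Space M] (h : IsPleatedPosition ι δ e) : IsOpen (outerPart ι δ (e 0)) :=
  (isOpen_lt continuous_const (continuous_height h.1)).sdiff
    ((isCompact_closedBall (0 : EuclideanSpace ℝ (Fin 4)) 2).image (h.2.2.2.2.1 0).1.contMDiff.continuous).isClosed

/-- The closed outer part is compact (for a compact `M`). -/
theorem isCompact_outerPartK [CompactSpace M] [IsManifold (𝓡 4) ∞ M] (h : IsPleatedPosition ι δ e) :
    IsCompact (outerPartK ι δ (e 0)) :=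
  ((isClosed_le continuous_const (continuous_height h.1)).sdiff
    (isOpenMap_pleatChart (h.2.2.2.2.1 0).1 _ isOpen_ball)).isCompact

/-- The shadow of the closed outer part is closed. -/
theorem isClosed_shadow_outerPartK [CompactSpace M] [IsManifold (𝓡 4) ∞ M] (h : IsPleatedPosition ι δ e) :
    IsClosed ((proj5 ∘ ι) '' outerPartK ι δ (e 0)) :=
  ((isCompact_outerPartK h).image (contMDiff_shadow h.1).continuous).isClosed

/-- The shadow of a closed subset of the closed outer part is closed. -/
theorem isClosed_shadow_outerPartK_diff [CompactSpace M] [IsManifold (𝓡 4) ∞ M] (h : IsPleatedPosition ι δ e)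
    {U : Set M} (hU : IsOpen U) : IsClosed ((proj5 ∘ ι) '' (outerPartK ι δ (e 0) \ U)) :=
  (((isCompact_outerPartK h).diff hU).image (contMDiff_shadow h.1).continuous).isClosed

/-- At a point of the outer part the shadow differential is injective. -/
theorem injective_mfderiv_shadow_of_mem_outerPart (h : IsPleatedPosition ι δ e) {m : M} (hm : m ∈ outerPart ι δ (e 0)) :
    Injective (mfderiv (𝓡 4) (𝓡 4) (proj5 ∘ ι) m) := by
  refine h.2.2.2.2.2.2.1 m hm.1 ?_
  simp only [Set.mem_iUnion, not_exists]
  intro j hj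
  obtain rfl : j = 0 := Subsingleton.elim j 0
  exact hm.2 (Set.image_mono (pleatSpheres_subset_closedBall le_rfl) hj)

/-- **Local injectivity and openness of the shadow at points of the outer part**: inside any
open `W ∋ m` there is an open `U`, `m ∈ U ⊆ W ∩ P⁺`, on which the shadow is injective and open. -/
theorem exists_nhds_injOn_outerPart [T2Space M] [IsManifold (𝓡 4) ∞ M] (h : IsPleatedPosition ι δ e) {m : M}
    (hm : m ∈ outerPart ι δ (e 0)) {W : Set M} (hW : IsOpen W) (hmW : m ∈ W) :
    ∃ U : Set M, IsOpen U ∧ m ∈ U ∧ U ⊆ W ∩ outerPart ι δ (e 0) ∧ InjOn (proj5 ∘ ι) U ∧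
      ∀ V, V ⊆ U → IsOpen V → IsOpen ((proj5 ∘ ι) '' V) :=
  exists_nhds_injOn_of_injective_mfderiv h.1 (injective_mfderiv_shadow_of_mem_outerPart h hm)
    (hW.inter (isOpen_outerPart h)) ⟨hmW, hm⟩

/-! ### Openness of the counting sets -/

/-- **Two sheets is an open condition** (everywhere). -/
theorem isOpen_sheet2 [T2Space M] [IsManifold (𝓡 4) ∞ M] (h : IsPleatedPosition ι δ e) : IsOpen (sheet2 ι δ (e 0)) := by
  rw [Metric.isOpen_iff]
  rintro y ⟨a, ha, b, hb, hne, hay, hby⟩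
  obtain ⟨ua, ub, hua, hub, haua, hbub, hdisj⟩ := t2_separation hne
  obtain ⟨Ua, hUa, haUa, hUaW, -, himga⟩ := exists_nhds_injOn_outerPart h ha hua haua
  obtain ⟨Ub, hUb, hbUb, hUbW, -, himgb⟩ := exists_nhds_injOn_outerPart h hb hub hbub
  obtain ⟨εa, hεa, hballa⟩ := Metric.isOpen_iff.1 (himga Ua Subset.rfl hUa) y ⟨a, haUa, hay⟩
  obtain ⟨εb, hεb, hballb⟩ := Metric.isOpen_iff.1 (himgb Ub Subset.rfl hUb) y ⟨b, hbUb, hby⟩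
  refine ⟨min εa εb, by positivity, fun z hz => ?_⟩
  obtain ⟨a', ha'U, ha'z⟩ := hballa (Metric.ball_subset_ball (min_le_left _ _) hz)
  obtain ⟨b', hb'U, hb'z⟩ := hballb (Metric.ball_subset_ball (min_le_right _ _) hz)
  have hne' : a' ≠ b' := by
    intro hab
    exact Set.disjoint_left.1 hdisj (hUaW ha'U).1 (hab ▸ (hUbW hb'U).1)
  exact ⟨a', (hUaW ha'U).2, b', (hUbW hb'U).2, hne', ha'z, hb'z⟩

omit [TopologicalSpace M] [ChartedSpace (EuclideanSpace ℝ (Fin 4)) M] in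
/-- Off the shadow of the closed outer part there is no sheet. -/
theorem mem_sheet0_of_not_mem_shadow {y : EuclideanSpace ℝ (Fin 4)} (hy : y ∉ (proj5 ∘ ι) '' outerPartK ι δ (e 0)) :
    y ∈ sheet0 ι δ (e 0) := fun m hm hmy => hy ⟨m, outerPart_subset_outerPartK hm, hmy⟩

/-- Off `S_ρ ∪ c_out`, no sheet means: off the shadow of the closed outer part. -/
theorem not_mem_shadow_of_mem_sheet0 (h : IsPleatedPosition ι δ e) {y : EuclideanSpace ℝ (Fin 4)} (hy : y ∈ sheet0 ι δ (e 0))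
    (hyΩ : y ∉ Metric.sphere (0 : EuclideanSpace ℝ (Fin 4)) (Real.sqrt (1 - (1 - δ) ^ 2)) ∪ (proj5 ∘ ι ∘ e 0) '' Metric.sphere 0 2) :
    y ∉ (proj5 ∘ ι) '' outerPartK ι δ (e 0) := by
  rintro ⟨m, hm, hmy⟩
  by_cases hP : m ∈ outerPart ι δ (e 0)
  · exact hy m hP hmy
  · exact hyΩ (hmy ▸ shadow_mem_of_mem_diff h hm hP)

/-- **No sheet is locally constant off `S_ρ ∪ c_out`.** -/
theorem exists_ball_subset_sheet0 [CompactSpace M] [IsManifold (𝓡 4) ∞ M] (h : IsPleatedPosition ι δ e)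
    {y : EuclideanSpace ℝ (Fin 4)} (hy : y ∈ sheet0 ι δ (e 0))
    (hyΩ : y ∉ Metric.sphere (0 : EuclideanSpace ℝ (Fin 4)) (Real.sqrt (1 - (1 - δ) ^ 2)) ∪ (proj5 ∘ ι ∘ e 0) '' Metric.sphere 0 2) :
    ∃ ε : ℝ, 0 < ε ∧ Metric.ball y ε ⊆ sheet0 ι δ (e 0) := by
  obtain ⟨ε, hε, hball⟩ := Metric.isOpen_iff.1 (isClosed_shadow_outerPartK h).isOpen_compl y
    (not_mem_shadow_of_mem_sheet0 h hy hyΩ)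
  exact ⟨ε, hε, fun z hz => mem_sheet0_of_not_mem_shadow (hball hz)⟩

/-- **One sheet is locally constant off `S_ρ ∪ c_out`.** -/
theorem exists_ball_subset_sheet1 [T2Space M] [CompactSpace M] [IsManifold (𝓡 4) ∞ M] (h : IsPleatedPosition ι δ e)
    {y : EuclideanSpace ℝ (Fin 4)} (hy : y ∈ sheet1 ι δ (e 0))
    (hyΩ : y ∉ Metric.sphere (0 : EuclideanSpace ℝ (Fin 4)) (Real.sqrt (1 - (1 - δ) ^ 2)) ∪ (proj5 ∘ ι ∘ e 0) '' Metric.sphere 0 2) :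
    ∃ ε : ℝ, 0 < ε ∧ Metric.ball y ε ⊆ sheet1 ι δ (e 0) := by
  obtain ⟨m₁, hm₁, hm₁y, huniq⟩ := hy
  obtain ⟨U, hU, hm₁U, hUW, hinjU, himg⟩ := exists_nhds_injOn_outerPart h hm₁ isOpen_univ (mem_univ _)
  have hC := isClosed_shadow_outerPartK_diff h hU
  have hy_not : y ∉ (proj5 ∘ ι) '' (outerPartK ι δ (e 0) \ U) := by
    rintro ⟨c, ⟨hcK, hcU⟩, hcy⟩
    by_cases hcP : c ∈ outerPart ι δ (e 0)
    · exact hcU (huniq c hcP hcy ▸ hm₁U)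
    · exact hyΩ (hcy ▸ shadow_mem_of_mem_diff h hcK hcP)
  obtain ⟨ε₁, hε₁, hball₁⟩ := Metric.isOpen_iff.1 hC.isOpen_compl y hy_not
  obtain ⟨ε₂, hε₂, hball₂⟩ := Metric.isOpen_iff.1 (himg U Subset.rfl hU) y ⟨m₁, hm₁U, hm₁y⟩
  refine ⟨min ε₁ ε₂, by positivity, fun z hz => ?_⟩
  obtain ⟨mz, hmzU, hmzz⟩ := hball₂ (Metric.ball_subset_ball (min_le_right _ _) hz)
  refine ⟨mz, (hUW hmzU).2, hmzz, fun m' hm' hm'z => ?_⟩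
  have hm'U : m' ∈ U := by
    by_contra hnot
    exact hball₁ (Metric.ball_subset_ball (min_le_left _ _) hz) ⟨m', ⟨outerPart_subset_outerPartK hm', hnot⟩, hm'z⟩
  exact hinjU hm'U hmzU (hm'z.trans hmzz.symm)

/-- **THE COUNTING SETS ARE LOCALLY CONSTANT off `S_ρ ∪ c_out`** (registered helper of file G):
around every point `y` off the seam sphere and the outer crease there is a ball lying in the
same counting set as `y` (and missing the two others, by trichotomy). [folklore] -/
theorem exists_ball_sheets_const [T2Space M] [CompactSpace M] [IsManifold (𝓡 4) ∞ M] (h : IsPleatedPosition ι δ e) {y : EuclideanSpace ℝ (Fin 4)} (hyΩ : y ∉ Metric.sphere (0 : EuclideanSpace ℝ (Fin 4)) (Real.sqrt (1 - (1 - δ) ^ 2)) ∪ (proj5 ∘ ι ∘ e 0) '' Metric.sphere 0 2) : ∃ ε : ℝ, 0 < ε ∧ ((y ∈ sheet0 ι δ (e 0) → Metric.ball y ε ⊆ sheet0 ι δ (e 0)) ∧ (y ∈ sheet1 ι δ (e 0) → Metric.ball y ε ⊆ sheet1 ι δ (e 0)) ∧ (y ∈ sheet2 ι δ (e 0) → Metric.ball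 y ε ⊆ sheet2 ι δ (e 0))) := by
  rcases mem_sheet0_or (ι := ι) (δ := δ) (e₀ := e 0) y with h0 | h1 | h2
  · obtain ⟨ε, hε, hball⟩ := exists_ball_subset_sheet0 h h0 hyΩ
    exact ⟨ε, hε, fun _ => hball, fun h1 => absurd h1 (not_mem_sheet1_of_mem_sheet0 h0),
      fun h2 => absurd h2 (not_mem_sheet2_of_mem_sheet0 h0)⟩
  · obtain ⟨ε, hε, hball⟩ := exists_ball_subset_sheet1 h h1 hyΩ
    exact ⟨ε, hε, fun h0 => absurd h1 (not_mem_sheet1_of_mem_sheet0 h0), fun _ => hball,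
      fun h2 => absurd h2 (not_mem_sheet2_of_mem_sheet1 h1)⟩
  · obtain ⟨ε, hε, hball⟩ := Metric.isOpen_iff.1 (isOpen_sheet2 h) y h2
    exact ⟨ε, hε, fun h0 => absurd h2 (not_mem_sheet2_of_mem_sheet0 h0),
      fun h1 => absurd h2 (not_mem_sheet2_of_mem_sheet1 h1), fun _ => hball⟩

/-- A connected set off `S_ρ ∪ c_out` lies entirely in one counting set: if it meets `sheet0`
it is contained in it. -/
theorem subset_sheet0_of_isPreconnected [T2Space M] [CompactSpace M] [IsManifold (𝓡 4) ∞ M] (h : IsPleatedPosition ι δ e)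
    {B : Set (EuclideanSpace ℝ (Fin 4))} (hB : IsPreconnected B)
    (hBΩ : Disjoint B (Metric.sphere (0 : EuclideanSpace ℝ (Fin 4)) (Real.sqrt (1 - (1 - δ) ^ 2)) ∪ (proj5 ∘ ι ∘ e 0) '' Metric.sphere 0 2))
    {y : EuclideanSpace ℝ (Fin 4)} (hy : y ∈ B) (hy0 : y ∈ sheet0 ι δ (e 0)) : B ⊆ sheet0 ι δ (e 0) := by
  -- `sheet0 ∩ Ω` and `(sheet1 ∪ sheet2) ∩ Ω` are open (relative to the open `Ω`)
  set Ω := (Metric.sphere (0 : EuclideanSpace ℝ (Fin 4)) (Real.sqrt (1 - (1 - δ) ^ 2)) ∪ (proj5 ∘ ι ∘ e 0) '' Metric.sphere 0 2)ᶜ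
  set U₀ : Set (EuclideanSpace ℝ (Fin 4)) := {z | ∃ ε : ℝ, 0 < ε ∧ Metric.ball z ε ⊆ sheet0 ι δ (e 0)} with hU₀
  set U₁ : Set (EuclideanSpace ℝ (Fin 4)) := {z | ∃ ε : ℝ, 0 < ε ∧ Metric.ball z ε ⊆ sheet1 ι δ (e 0) ∪ sheet2 ι δ (e 0)}
    with hU₁
  have hopen : ∀ S : Set (EuclideanSpace ℝ (Fin 4)), IsOpen {z | ∃ ε : ℝ, 0 < ε ∧ Metric.ball z ε ⊆ S} := by
    intro S
    rw [Metric.isOpen_iff]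
    rintro z ⟨ε, hε, hball⟩
    refine ⟨ε / 2, by positivity, fun w hw => ⟨ε / 2, by positivity, fun v hv => hball ?_⟩⟩
    rw [Metric.mem_ball] at hw hv ⊢
    linarith [dist_triangle v w z]
  have hcover : B ⊆ U₀ ∪ U₁ := fun z hz => by
    have hzΩ : z ∉ Metric.sphere (0 : EuclideanSpace ℝ (Fin 4)) (Real.sqrt (1 - (1 - δ) ^ 2)) ∪
        (proj5 ∘ ι ∘ e 0) '' Metric.sphere 0 2 := Set.disjoint_left.1 hBΩ hz
    obtain ⟨ε, hε, h0, h1, h2⟩ := exists_ball_sheets_const h hzΩ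
    rcases mem_sheet0_or (ι := ι) (δ := δ) (e₀ := e 0) z with hz0 | hz1 | hz2
    · exact Or.inl ⟨ε, hε, h0 hz0⟩
    · exact Or.inr ⟨ε, hε, (h1 hz1).trans subset_union_left⟩
    · exact Or.inr ⟨ε, hε, (h2 hz2).trans subset_union_right⟩
  have hdisj : Disjoint U₀ U₁ := Set.disjoint_left.2 fun z ⟨ε, hε, h0⟩ ⟨ε', hε', h1⟩ => by
    have hz0 : z ∈ sheet0 ι δ (e 0) := h0 (mem_ball_self hε)
    rcases h1 (mem_ball_self hε') with hz1 | hz2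
    · exact not_mem_sheet1_of_mem_sheet0 hz0 hz1
    · exact not_mem_sheet2_of_mem_sheet0 hz0 hz2
  have hyU₀ : y ∈ U₀ := by
    obtain ⟨ε, hε, h0, -, -⟩ := exists_ball_sheets_const h (Set.disjoint_left.1 hBΩ hy)
    exact ⟨ε, hε, h0 hy0⟩
  have hsub := hB.subset_left_of_subset_union (hopen _) (hopen _) hdisj hcover ⟨y, hy, hyU₀⟩
  exact fun z hz => by
    obtain ⟨ε, hε, hball⟩ := hsub hz
    exact hball (mem_ball_self hε)

/-- A connected set off `S_ρ ∪ c_out` meeting `sheet1` is contained in it. -/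
theorem subset_sheet1_of_isPreconnected [T2Space M] [CompactSpace M] [IsManifold (𝓡 4) ∞ M] (h : IsPleatedPosition ι δ e)
    {B : Set (EuclideanSpace ℝ (Fin 4))} (hB : IsPreconnected B)
    (hBΩ : Disjoint B (Metric.sphere (0 : EuclideanSpace ℝ (Fin 4)) (Real.sqrt (1 - (1 - δ) ^ 2)) ∪ (proj5 ∘ ι ∘ e 0) '' Metric.sphere 0 2))
    {y : EuclideanSpace ℝ (Fin 4)} (hy : y ∈ B) (hy1 : y ∈ sheet1 ι δ (e 0)) : B ⊆ sheet1 ι δ (e 0) := by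
  set U₀ : Set (EuclideanSpace ℝ (Fin 4)) := {z | ∃ ε : ℝ, 0 < ε ∧ Metric.ball z ε ⊆ sheet1 ι δ (e 0)} with hU₀
  set U₁ : Set (EuclideanSpace ℝ (Fin 4)) := {z | ∃ ε : ℝ, 0 < ε ∧ Metric.ball z ε ⊆ sheet0 ι δ (e 0) ∪ sheet2 ι δ (e 0)}
    with hU₁
  have hopen : ∀ S : Set (EuclideanSpace ℝ (Fin 4)), IsOpen {z | ∃ ε : ℝ, 0 < ε ∧ Metric.ball z ε ⊆ S} := by
    intro S
    rw [Metric.isOpen_iff]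
    rintro z ⟨ε, hε, hball⟩
    refine ⟨ε / 2, by positivity, fun w hw => ⟨ε / 2, by positivity, fun v hv => hball ?_⟩⟩
    rw [Metric.mem_ball] at hw hv ⊢
    linarith [dist_triangle v w z]
  have hcover : B ⊆ U₀ ∪ U₁ := fun z hz => by
    have hzΩ : z ∉ Metric.sphere (0 : EuclideanSpace ℝ (Fin 4)) (Real.sqrt (1 - (1 - δ) ^ 2)) ∪
        (proj5 ∘ ι ∘ e 0) '' Metric.sphere 0 2 := Set.disjoint_left.1 hBΩ hz
    obtain ⟨ε, hε, h0, h1, h2⟩ := exists_ball_sheets_const h hzΩ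
    rcases mem_sheet0_or (ι := ι) (δ := δ) (e₀ := e 0) z with hz0 | hz1 | hz2
    · exact Or.inr ⟨ε, hε, (h0 hz0).trans subset_union_left⟩
    · exact Or.inl ⟨ε, hε, h1 hz1⟩
    · exact Or.inr ⟨ε, hε, (h2 hz2).trans subset_union_right⟩
  have hdisj : Disjoint U₀ U₁ := Set.disjoint_left.2 fun z ⟨ε, hε, h1⟩ ⟨ε', hε', h0⟩ => by
    have hz1 : z ∈ sheet1 ι δ (e 0) := h1 (mem_ball_self hε)
    rcases h0 (mem_ball_self hε') with hz0 | hz2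
    · exact not_mem_sheet1_of_mem_sheet0 hz0 hz1
    · exact not_mem_sheet2_of_mem_sheet1 hz1 hz2
  have hyU₀ : y ∈ U₀ := by
    obtain ⟨ε, hε, -, h1, -⟩ := exists_ball_sheets_const h (Set.disjoint_left.1 hBΩ hy)
    exact ⟨ε, hε, h1 hy1⟩
  have hsub := hB.subset_left_of_subset_union (hopen _) (hopen _) hdisj hcover ⟨y, hy, hyU₀⟩
  exact fun z hz => by
    obtain ⟨ε, hε, hball⟩ := hsub hz
    exact hball (mem_ball_self hε)

end Pleated

end Summit.SmoothPoincare4.SmoothPoincare4.Theorems.OrigamiFoldExistence.ShadowPleats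

end
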